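import Summits.QuantumFields.YangMills.Theorems.SwapVirialDeficitTwoScaleCalculusMin
import HarnessLib

/-!
# RAY JETS ⟹ THE TAYLOR DATUM: from the one-sided quartic Taylor remainders along the rays `t ↦ f(p + t·y)` and `t ↦ f(p − t·y)` to
# `∃ τ odd, |τ y| ≤ B₃‖y‖³ ∧ |f(p+y) − f(p) − ½⟪A y, y⟫ − τ y| ≤ B₄‖y‖⁴` with `A` THE HESSIAN OPERATOR (symmetric, Riesz) — no polarisation needed
# (free-hands support of ⟨stmt-QuantumFields-24197⟩ `SwapVirialDeficit.SwapGluedStiffness`; generic calculus glue between fcl-p3 g47's ray∕line jets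
# ✓`Gnomonic.taylor_four_chartDeficit_gnomonic` ∕ `taylor_four_gnoDeficit_line` and the `hfT`∕`hT` hypothesis of w2 g58's ✓`laplaceMethod_quantitative_fibred_of_taylor`
# and of ✓`BlowUpRing.follower_coercivity_of_taylor`; brick W3 ∕ W4 interface of LEAD ym-line-sfw-p2 g97's steep-window Morse–Bott plan)

The consumers want, per base point, a SYMMETRIC OPERATOR `A` with `λ‖y‖² ≤ ⟪Ay,y⟫` and `∃ τ odd, |τ y| ≤ B₃‖y‖³, |f y − ½⟪A y,y⟫ − τ y| ≤ B₄‖y‖⁴` on `‖y‖ ≤ R`;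
the producers give, for every direction, the 1-D jets of `φ_y(t) = f(p + t·y)`: `|φ_y⁽ᵏ⁾| ≤ A_k‖y‖ᵏ` and the one-sided remainders
`|φ_y(1) − φ_y(0) − φ_y′(0) − φ_y″(0)/2 − φ_y‴(0)/6| ≤ (A₄/24)‖y‖⁴`.  The bridge is PARITY, not polarisation: with `τ(y) := (f(p+y) − f(p−y))/2` (odd by construction)
and `φ_{−y}(t) = φ_y(−t)` (so `φ_{−y}′(0) = −φ_y′(0)`, `φ_{−y}″(0) = φ_y″(0)`, `φ_{−y}‴(0) = −φ_y‴(0)`: Mathlib `deriv_comp_neg`, `iteratedDeriv_comp_neg`), the EVEN part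
`(f(p+y)+f(p−y))/2 − f(p) − φ_y″(0)/2` is the average of the two quartic remainders and the ODD part is `φ_y′(0) + φ_y‴(0)/6 +` (half their difference):
* §1 `ray_neg_eq`, `deriv_ray_neg`, `iteratedDeriv_two_ray_neg`, `iteratedDeriv_three_ray_neg` (parity of ray jets);
* §2 ★★★ `taylor_datum_of_rays` — at a ray-critical origin (`φ_y′(0) = 0`), `|φ_y‴(0)| ≤ B₃‖y‖³` and the two-sided quartic remainders `≤ B₄‖y‖⁴` on `‖y‖ ≤ R` give
  `∃ τ odd, |τ y| ≤ (B₃/6 + B₄R)‖y‖³ ∧ |f y − f 0 − ½φ_y″(0) − τ y| ≤ B₄‖y‖⁴`; ★ `taylor_datum_of_rays_linear` (non-critical origin: the linear term `φ_y′(0)` joins `τ`,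
  bound `(B₁ + B₃/6 + B₄R)‖y‖³` under `|φ_y′(0)| ≤ B₁‖y‖³`); ★ `cubic_datum_of_rays` (the `1/√β` core's datum `|f y − f 0 − ½φ_y″(0)| ≤ (B₃/6 + B₄R)·‖y‖³ + …` — stated as
  `≤ B‖y‖³` from the one-sided CUBIC remainder, no parity);
* §3 ★★ `exists_isSymmetric_inner_eq_hess` — on a real Hilbert space the Hessian form `hess f p` (✓`TwoScaleCalculus.hess`, symmetric by ✓`hess_comm`) is `⟪A·,·⟫` for a
  SYMMETRIC `A : W →ₗ[ℝ] W` (Mathlib `InnerProductSpace.continuousLinearMapOfBilin`), with `⟪A y, y⟫ = φ_y″(0)` (✓`iteratedDeriv_two_line_eq_hess`);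
  ★★★ `exists_symmOp_taylor_datum` — THE PACKAGE: `C^∞ f`, base point `p`, ray-critical, ray jets ⟹ `∃ A symmetric, (∀ y w, ⟪A y,w⟫ = D²f(p)[y,w]) ∧ ∃ τ odd, cubic ∧
  |f(p+y) − f(p) − ½⟪A y,y⟫ − τ y| ≤ B₄‖y‖⁴` — literally the `hfT` of ✓`laplaceMethod_quantitative_fibred_of_taylor` ∕ the `hT` of ✓`follower_coercivity_of_taylor[_twisted]`
  for the normalised fibre function `y ↦ f(p+y) − f(p)`.

HONEST LABEL: generic calculus (Mathlib + ✓`…TwoScaleCalculusMin` only); nothing model-side; ⟨24197⟩ ∕ ⟨24196⟩ ∕ ⟨24194⟩ ∕ ⟨24497⟩ OPEN; own crux ⟨22884⟩ OPEN (blocked-on ⟨19935⟩);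
no crux, rung of record or summit is proved; the Yang–Mills mass gap is NOT proved; no summit is proved by a line.  THEOREMS ONLY (0 `def`, 0 `sorry`), standard axioms.
Width seat ym-line-sfw-p2-w3 g65 (cell ym-idea-1, free hands), `--supports stmt-QuantumFields-24197`.  References: [folklore] (Taylor's theorem; Riesz representation).
-/

set_option autoImplicit false

noncomputable section

open Set Filter Topology InnerProductSpace
open scoped BigOperators ContDiff RealInnerProductSpace

namespace Summit.QuantumFields.YangMills.Theorems.QuantitativeLaplace

open Summit.QuantumFields.YangMills.Theorems.SwapVirialDeficit.TwoScaleCalculus (hess hess_comm iteratedDeriv_two_line_eq_hess)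

/-! ## §1 Parity of ray jets -/

section Parity

variable {V : Type*} [NormedAddCommGroup V] [NormedSpace ℝ V]

/-- The ray through `−y` is the ray through `y` run backwards. [folklore] -/
theorem ray_neg_eq (f : V → ℝ) (y : V) : (fun t : ℝ => f (t • -y)) = fun t : ℝ => (fun s : ℝ => f (s • y)) (-t) := by
  funext t; simp only [smul_neg, neg_smul]

/-- `φ_{−y}′(0) = −φ_y′(0)`. [folklore] -/
theorem deriv_ray_neg (f : V → ℝ) (y : V) : deriv (fun t : ℝ => f (t • -y)) 0 = -deriv (fun t : ℝ => f (t • y)) 0 := by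
  rw [ray_neg_eq, deriv_comp_neg (fun s : ℝ => f (s • y)) 0, neg_zero]

/-- `φ_{−y}″(0) = φ_y″(0)`. [folklore] -/
theorem iteratedDeriv_two_ray_neg (f : V → ℝ) (y : V) :
    iteratedDeriv 2 (fun t : ℝ => f (t • -y)) 0 = iteratedDeriv 2 (fun t : ℝ => f (t • y)) 0 := by
  rw [ray_neg_eq, iteratedDeriv_comp_neg 2 (fun s : ℝ => f (s • y)) 0, neg_zero]; norm_num

/-- `φ_{−y}‴(0) = −φ_y‴(0)`. [folklore] -/
theorem iteratedDeriv_three_ray_neg (f : V → ℝ) (y : V) :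
    iteratedDeriv 3 (fun t : ℝ => f (t • -y)) 0 = -iteratedDeriv 3 (fun t : ℝ => f (t • y)) 0 := by
  rw [ray_neg_eq, iteratedDeriv_comp_neg 3 (fun s : ℝ => f (s • y)) 0, neg_zero]; norm_num

end Parity

/-! ## §2 The Taylor datum from two-sided ray remainders -/

section Datum

variable {V : Type*} [NormedAddCommGroup V] [NormedSpace ℝ V]

/-- ★★★ **RAY JETS ⟹ TAYLOR DATUM** (critical origin).  If along every ray `φ_y(t) = f(t·y)`, `‖y‖ ≤ R`: `φ_y′(0) = 0`, `|φ_y‴(0)| ≤ B₃‖y‖³`, and the quartic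
remainder `|f y − f 0 − φ_y′(0) − φ_y″(0)/2 − φ_y‴(0)/6| ≤ B₄‖y‖⁴`, then with the ODD function `τ y := (f y − f(−y))/2`:
`|τ y| ≤ (B₃/6 + B₄R)‖y‖³` and `|f y − f 0 − ½φ_y″(0) − τ y| ≤ B₄‖y‖⁴` on the ball — parity replaces polarisation. [folklore] -/
theorem taylor_datum_of_rays {f : V → ℝ} {R B₃ B₄ : ℝ} (hB₄ : 0 ≤ B₄)
    (hcrit : ∀ y : V, ‖y‖ ≤ R → deriv (fun t : ℝ => f (t • y)) 0 = 0)
    (h3 : ∀ y : V, ‖y‖ ≤ R → |iteratedDeriv 3 (fun t : ℝ => f (t • y)) 0| ≤ B₃ * ‖y‖ ^ 3)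
    (h4 : ∀ y : V, ‖y‖ ≤ R → |f y - f 0 - deriv (fun t : ℝ => f (t • y)) 0 - iteratedDeriv 2 (fun t : ℝ => f (t • y)) 0 / 2 -
        iteratedDeriv 3 (fun t : ℝ => f (t • y)) 0 / 6| ≤ B₄ * ‖y‖ ^ 4) :
    ∃ τ : V → ℝ, (∀ y, τ (-y) = -τ y) ∧ (∀ y : V, ‖y‖ ≤ R → |τ y| ≤ (B₃ / 6 + B₄ * R) * ‖y‖ ^ 3) ∧
      ∀ y : V, ‖y‖ ≤ R → |f y - f 0 - (1 / 2) * iteratedDeriv 2 (fun t : ℝ => f (t • y)) 0 - τ y| ≤ B₄ * ‖y‖ ^ 4 := by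
  refine ⟨fun y => (f y - f (-y)) / 2, fun y => by simp only [neg_neg]; ring, fun y hy => ?_, fun y hy => ?_⟩
  · have hy' : ‖-y‖ ≤ R := by rwa [norm_neg]
    have hp := abs_le.1 (h4 y hy)
    have hm := abs_le.1 (h4 (-y) hy')
    have h3y := abs_le.1 (h3 y hy)
    have e1 := deriv_ray_neg f y
    have e2 := iteratedDeriv_two_ray_neg f y
    have e3 := iteratedDeriv_three_ray_neg f y
    have hc := hcrit y hy
    rw [norm_neg] at hm
    have hn0 : 0 ≤ ‖y‖ := norm_nonneg y
    have hR : ‖y‖ ^ 4 ≤ R * ‖y‖ ^ 3 := by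
      have : ‖y‖ ^ 4 = ‖y‖ * ‖y‖ ^ 3 := by ring
      rw [this]; exact mul_le_mul_of_nonneg_right hy (by positivity)
    have hB : B₄ * ‖y‖ ^ 4 ≤ B₄ * R * ‖y‖ ^ 3 := by rw [mul_assoc]; exact mul_le_mul_of_nonneg_left hR hB₄
    rw [abs_le]
    constructor <;> nlinarith [hp.1, hp.2, hm.1, hm.2, h3y.1, h3y.2, hB]
  · have hy' : ‖-y‖ ≤ R := by rwa [norm_neg]
    have hp := abs_le.1 (h4 y hy)
    have hm := abs_le.1 (h4 (-y) hy')
    have e1 := deriv_ray_neg f y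
    have e2 := iteratedDeriv_two_ray_neg f y
    have e3 := iteratedDeriv_three_ray_neg f y
    have hc := hcrit y hy
    rw [norm_neg] at hm
    rw [abs_le]
    constructor <;> linarith [hp.1, hp.2, hm.1, hm.2]

/-- ★ **Non-critical origin**: if instead `|φ_y′(0)| ≤ B₁‖y‖³` on the ball, the same `τ` works with `|τ y| ≤ (B₁ + B₃/6 + B₄R)‖y‖³`. [folklore] -/
theorem taylor_datum_of_rays_linear {f : V → ℝ} {R B₁ B₃ B₄ : ℝ} (hB₄ : 0 ≤ B₄)
    (h1 : ∀ y : V, ‖y‖ ≤ R → |deriv (fun t : ℝ => f (t • y)) 0| ≤ B₁ * ‖y‖ ^ 3)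
    (h3 : ∀ y : V, ‖y‖ ≤ R → |iteratedDeriv 3 (fun t : ℝ => f (t • y)) 0| ≤ B₃ * ‖y‖ ^ 3)
    (h4 : ∀ y : V, ‖y‖ ≤ R → |f y - f 0 - deriv (fun t : ℝ => f (t • y)) 0 - iteratedDeriv 2 (fun t : ℝ => f (t • y)) 0 / 2 -
        iteratedDeriv 3 (fun t : ℝ => f (t • y)) 0 / 6| ≤ B₄ * ‖y‖ ^ 4) :
    ∃ τ : V → ℝ, (∀ y, τ (-y) = -τ y) ∧ (∀ y : V, ‖y‖ ≤ R → |τ y| ≤ (B₁ + B₃ / 6 + B₄ * R) * ‖y‖ ^ 3) ∧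
      ∀ y : V, ‖y‖ ≤ R → |f y - f 0 - (1 / 2) * iteratedDeriv 2 (fun t : ℝ => f (t • y)) 0 - τ y| ≤ B₄ * ‖y‖ ^ 4 := by
  refine ⟨fun y => (f y - f (-y)) / 2, fun y => by simp only [neg_neg]; ring, fun y hy => ?_, fun y hy => ?_⟩
  · have hy' : ‖-y‖ ≤ R := by rwa [norm_neg]
    have hp := abs_le.1 (h4 y hy)
    have hm := abs_le.1 (h4 (-y) hy')
    have h3y := abs_le.1 (h3 y hy)
    have h1y := abs_le.1 (h1 y hy)
    have e1 := deriv_ray_neg f y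
    have e2 := iteratedDeriv_two_ray_neg f y
    have e3 := iteratedDeriv_three_ray_neg f y
    rw [norm_neg] at hm
    have hn0 : 0 ≤ ‖y‖ := norm_nonneg y
    have hR : ‖y‖ ^ 4 ≤ R * ‖y‖ ^ 3 := by
      have : ‖y‖ ^ 4 = ‖y‖ * ‖y‖ ^ 3 := by ring
      rw [this]; exact mul_le_mul_of_nonneg_right hy (by positivity)
    have hB : B₄ * ‖y‖ ^ 4 ≤ B₄ * R * ‖y‖ ^ 3 := by rw [mul_assoc]; exact mul_le_mul_of_nonneg_left hR hB₄
    rw [abs_le]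
    constructor <;> nlinarith [hp.1, hp.2, hm.1, hm.2, h3y.1, h3y.2, h1y.1, h1y.2, hB]
  · have hy' : ‖-y‖ ≤ R := by rwa [norm_neg]
    have hp := abs_le.1 (h4 y hy)
    have hm := abs_le.1 (h4 (-y) hy')
    have e1 := deriv_ray_neg f y
    have e2 := iteratedDeriv_two_ray_neg f y
    have e3 := iteratedDeriv_three_ray_neg f y
    rw [norm_neg] at hm
    rw [abs_le]
    constructor <;> linarith [hp.1, hp.2, hm.1, hm.2]

/-- ★ **The cubic datum** (for the `1/√β` core ✓`laplaceMethod_quantitative_cubic`): at a ray-critical origin, the one-sided CUBIC remainder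
`|f y − f 0 − φ_y′(0) − φ_y″(0)/2| ≤ B‖y‖³` is already the datum `|f y − f 0 − ½φ_y″(0)| ≤ B‖y‖³` (no parity needed). [folklore] -/
theorem cubic_datum_of_rays {f : V → ℝ} {R B : ℝ}
    (hcrit : ∀ y : V, ‖y‖ ≤ R → deriv (fun t : ℝ => f (t • y)) 0 = 0)
    (h3 : ∀ y : V, ‖y‖ ≤ R → |f y - f 0 - deriv (fun t : ℝ => f (t • y)) 0 - iteratedDeriv 2 (fun t : ℝ => f (t • y)) 0 / 2| ≤ B * ‖y‖ ^ 3)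
    (y : V) (hy : ‖y‖ ≤ R) :
    |f y - f 0 - (1 / 2) * iteratedDeriv 2 (fun t : ℝ => f (t • y)) 0| ≤ B * ‖y‖ ^ 3 := by
  have h := h3 y hy
  rw [hcrit y hy, sub_zero] at h
  have e : f y - f 0 - (1 / 2) * iteratedDeriv 2 (fun t : ℝ => f (t • y)) 0 = f y - f 0 - iteratedDeriv 2 (fun t : ℝ => f (t • y)) 0 / 2 := by ring
  rw [e]; exact h

end Datum

/-! ## §3 The Hessian operator (Riesz) and the packaged datum at a base point -/

section Hessian

variable {W : Type*} [NormedAddCommGroup W] [InnerProductSpace ℝ W] [CompleteSpace W]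

/-- ★★ **THE HESSIAN OPERATOR**: for `C^∞ f` on a real Hilbert space and a point `p` there is a SYMMETRIC `A : W →ₗ[ℝ] W` with `⟪A y, w⟫ = D²f(p)[y][w]`
(`= hess f p y w`, ✓`TwoScaleCalculus.hess`; symmetric by ✓`hess_comm`; Riesz via Mathlib `continuousLinearMapOfBilin`). [folklore] -/
theorem exists_isSymmetric_inner_eq_hess {f : W → ℝ} (hf : ContDiff ℝ ∞ f) (p : W) :
    ∃ A : W →ₗ[ℝ] W, A.IsSymmetric ∧ ∀ y w : W, ⟪A y, w⟫ = hess f p y w := by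
  refine ⟨((continuousLinearMapOfBilin (𝕜 := ℝ) (hess f p) : W →L[ℝ] W) : W →ₗ[ℝ] W), fun y w => ?_, fun y w => ?_⟩
  · simp only [ContinuousLinearMap.coe_coe]
    rw [real_inner_comm (continuousLinearMapOfBilin (𝕜 := ℝ) (hess f p) w) y, continuousLinearMapOfBilin_apply,
      continuousLinearMapOfBilin_apply, hess_comm hf]
  · simp only [ContinuousLinearMap.coe_coe]
    exact continuousLinearMapOfBilin_apply (𝕜 := ℝ) (hess f p) y w

omit [CompleteSpace W] in
/-- The quadratic form of the Hessian operator is the second ray derivative: `⟪A y, y⟫ = φ_y″(0)` for `φ_y(t) = f(p + t·y)`. [folklore] -/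
theorem inner_eq_iteratedDeriv_two_of_hess {f : W → ℝ} (hf : ContDiff ℝ ∞ f) (p : W) {A : W →ₗ[ℝ] W}
    (hA : ∀ y w : W, ⟪A y, w⟫ = hess f p y w) (y : W) :
    ⟪A y, y⟫ = iteratedDeriv 2 (fun t : ℝ => f (p + t • y)) 0 := by
  rw [hA, iteratedDeriv_two_line_eq_hess hf]

/-- ★★★ **THE PACKAGED TAYLOR DATUM AT A BASE POINT.**  `C^∞ f : W → ℝ` on a real Hilbert space, base point `p`, radius `R`, ray-critical
(`d/dt f(p + t·y)|₀ = 0` for `‖y‖ ≤ R`), ray cubes `|d³/dt³ f(p+t·y)|₀| ≤ B₃‖y‖³`, two-sided... i.e. ONE-sided quartic ray remainders for all `‖y‖ ≤ R` (hence for `±y`)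
`|f(p+y) − f(p) − φ′(0) − φ″(0)/2 − φ‴(0)/6| ≤ B₄‖y‖⁴` ⟹
`∃ A symmetric with ⟪A y, w⟫ = D²f(p)[y][w], ∃ τ odd, |τ y| ≤ (B₃/6 + B₄R)‖y‖³ ∧ |f(p+y) − f(p) − ½⟪A y, y⟫ − τ y| ≤ B₄‖y‖⁴` on `‖y‖ ≤ R` —
the `hfT` of ✓`laplaceMethod_quantitative_fibred_of_taylor` ∕ the `hT` of ✓`follower_coercivity_of_taylor` for `y ↦ f(p+y) − f(p)`. [folklore] -/
theorem exists_symmOp_taylor_datum {f : W → ℝ} (hf : ContDiff ℝ ∞ f) (p : W) {R B₃ B₄ : ℝ} (hB₄ : 0 ≤ B₄)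
    (hcrit : ∀ y : W, ‖y‖ ≤ R → deriv (fun t : ℝ => f (p + t • y)) 0 = 0)
    (h3 : ∀ y : W, ‖y‖ ≤ R → |iteratedDeriv 3 (fun t : ℝ => f (p + t • y)) 0| ≤ B₃ * ‖y‖ ^ 3)
    (h4 : ∀ y : W, ‖y‖ ≤ R → |f (p + y) - f p - deriv (fun t : ℝ => f (p + t • y)) 0 - iteratedDeriv 2 (fun t : ℝ => f (p + t • y)) 0 / 2 -
        iteratedDeriv 3 (fun t : ℝ => f (p + t • y)) 0 / 6| ≤ B₄ * ‖y‖ ^ 4) :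
    ∃ A : W →ₗ[ℝ] W, A.IsSymmetric ∧ (∀ y w : W, ⟪A y, w⟫ = hess f p y w) ∧
      ∃ τ : W → ℝ, (∀ y, τ (-y) = -τ y) ∧ (∀ y : W, ‖y‖ ≤ R → |τ y| ≤ (B₃ / 6 + B₄ * R) * ‖y‖ ^ 3) ∧
        ∀ y : W, ‖y‖ ≤ R → |f (p + y) - f p - (1 / 2) * ⟪A y, y⟫ - τ y| ≤ B₄ * ‖y‖ ^ 4 := by
  obtain ⟨A, hAs, hA⟩ := exists_isSymmetric_inner_eq_hess hf p
  -- the translated function `g y = f (p + y)`: its rays are the rays of `f` through `p`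
  have hg0 : (fun y : W => f (p + y)) 0 = f p := by simp only [add_zero]
  obtain ⟨τ, hτo, hτb, hrem⟩ := taylor_datum_of_rays (f := fun y : W => f (p + y)) (R := R) (B₃ := B₃) (B₄ := B₄) hB₄ hcrit h3
    (fun y hy => by simpa only [add_zero] using h4 y hy)
  refine ⟨A, hAs, hA, τ, hτo, hτb, fun y hy => ?_⟩
  have h := hrem y hy
  rw [inner_eq_iteratedDeriv_two_of_hess hf p hA y]
  simpa only [add_zero] using h

end Hessian


/-! ## §4 (appended) The even remainder alone — the `hT` of ✓`follower_coercivity_of_taylor` at a NON-critical origin -/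

section Even

variable {V : Type*} [NormedAddCommGroup V] [NormedSpace ℝ V]

/-- ★★ **THE EVEN REMAINDER FROM TWO-SIDED RAY REMAINDERS, NO CRITICALITY, NO CUBIC BOUND**: if the one-sided quartic ray remainders are `≤ B₄‖y‖⁴` for all
`‖y‖ ≤ R`, then with the odd `τ y := (f y − f(−y))/2` (carrying the linear AND cubic terms, unbounded here)
`|f y − f 0 − ½φ_y″(0) − τ y| ≤ B₄‖y‖⁴` — exactly the `hT` shape of ✓`BlowUpRing.follower_coercivity_of_taylor[_twisted]` (whose odd part needs no bound), usable at the
reference point `U ≡ 1` over the NEAR-flat base where the fibre origin is not critical. [folklore] -/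
theorem taylor_even_remainder_of_rays {f : V → ℝ} {R B₄ : ℝ}
    (h4 : ∀ y : V, ‖y‖ ≤ R → |f y - f 0 - deriv (fun t : ℝ => f (t • y)) 0 - iteratedDeriv 2 (fun t : ℝ => f (t • y)) 0 / 2 -
        iteratedDeriv 3 (fun t : ℝ => f (t • y)) 0 / 6| ≤ B₄ * ‖y‖ ^ 4) :
    ∃ τ : V → ℝ, (∀ y, τ (-y) = -τ y) ∧
      ∀ y : V, ‖y‖ ≤ R → |f y - f 0 - (1 / 2) * iteratedDeriv 2 (fun t : ℝ => f (t • y)) 0 - τ y| ≤ B₄ * ‖y‖ ^ 4 := by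
  refine ⟨fun y => (f y - f (-y)) / 2, fun y => by simp only [neg_neg]; ring, fun y hy => ?_⟩
  have hy' : ‖-y‖ ≤ R := by rwa [norm_neg]
  have hp := abs_le.1 (h4 y hy)
  have hm := abs_le.1 (h4 (-y) hy')
  have e1 := deriv_ray_neg f y
  have e2 := iteratedDeriv_two_ray_neg f y
  have e3 := iteratedDeriv_three_ray_neg f y
  rw [norm_neg] at hm
  rw [abs_le]
  constructor <;> linarith [hp.1, hp.2, hm.1, hm.2]

end Even

section EvenHessian

variable {W : Type*} [NormedAddCommGroup W] [InnerProductSpace ℝ W] [CompleteSpace W]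

/-- ★★ **The packaged even remainder at a base point with the Hessian operator** (non-critical origin allowed): `C^∞ f`, one-sided quartic ray remainders at `p`
`≤ B₄‖y‖⁴` on `‖y‖ ≤ R` ⟹ `∃ A symmetric, ⟪A y, w⟫ = D²f(p)[y][w] ∧ ∃ τ odd, |f(p+y) − f(p) − ½⟪A y,y⟫ − τ y| ≤ B₄‖y‖⁴` — the `hT` of
✓`follower_coercivity_of_taylor[_twisted]` with `A` the Hessian operator of the fibre function at the reference point. [folklore] -/
theorem exists_symmOp_even_remainder {f : W → ℝ} (hf : ContDiff ℝ ∞ f) (p : W) {R B₄ : ℝ}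
    (h4 : ∀ y : W, ‖y‖ ≤ R → |f (p + y) - f p - deriv (fun t : ℝ => f (p + t • y)) 0 - iteratedDeriv 2 (fun t : ℝ => f (p + t • y)) 0 / 2 -
        iteratedDeriv 3 (fun t : ℝ => f (p + t • y)) 0 / 6| ≤ B₄ * ‖y‖ ^ 4) :
    ∃ A : W →ₗ[ℝ] W, A.IsSymmetric ∧ (∀ y w : W, ⟪A y, w⟫ = hess f p y w) ∧
      ∃ τ : W → ℝ, (∀ y, τ (-y) = -τ y) ∧
        ∀ y : W, ‖y‖ ≤ R → |f (p + y) - f p - (1 / 2) * ⟪A y, y⟫ - τ y| ≤ B₄ * ‖y‖ ^ 4 := by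
  obtain ⟨A, hAs, hA⟩ := exists_isSymmetric_inner_eq_hess hf p
  obtain ⟨τ, hτo, hrem⟩ := taylor_even_remainder_of_rays (f := fun y : W => f (p + y)) (R := R) (B₄ := B₄)
    (fun y hy => by simpa only [add_zero] using h4 y hy)
  refine ⟨A, hAs, hA, τ, hτo, fun y hy => ?_⟩
  have h := hrem y hy
  rw [inner_eq_iteratedDeriv_two_of_hess hf p hA y]
  simpa only [add_zero] using h

end EvenHessian

end Summit.QuantumFields.YangMills.Theorems.QuantitativeLaplace

end
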